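import Literature.Probability.Percolation.OnionDichotomy
import Literature.Probability.LatticeModels.StarZhangCrossing
import HarnessLib

/-!
# The random volume of the point-to-semicircuit lemma (Georgii–Higuchi 2000, Lemma 2.3)

Topic `Probability/Percolation`. Deterministic companion of `OnionDichotomy.lean` for the proof of
Georgii–Higuchi's Lemma 2.3 (point-to-semicircuit): GH consider, on the event `C` ("`x` is
surrounded by a `+∗`circuit in `Λ ∪ σ` which is `+∗`connected to `σ`"), "the largest random set
`Γ ⊂ Λ` containing `x` such that `∂Γ` forms a `+∗`circuit and is `+∗`connected to `σ`; by
maximality, `Γ` is determined from outside". In our circuit-free setting (finite hole-free `Λ`,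
colouring `η±` outside `Λ`):

* `innerReach Λ c s` — the sites of `Λ` reachable inside `Λ` from a site `∗`-adjacent to the
  outside strictly off the `s`-side by a `∗`-walk all of whose sites but the endpoint avoid
  `kSet Λ c s`; `onionDomain Λ c s = Λ ∖ innerReach Λ c s` — the random volume `Γ`;
* boundary properties: the `∗`-neighbours of `Γ` inside `Λ` lie in `kSet s`
  (`mem_kSet_of_adj_onionDomain`), those outside `Λ` are on the `s`-side
  (`onSide_of_adj_onionDomain`);
* `not_mem_xSet_iff` and **`onion_dichotomy'`** — `x ∈ kSet 1 ∨ x ∈ kSet (-1) ∨ x ∈ Γ⁺ ∨ x ∈ Γ⁻`;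
* monotonicity in the colouring (`kSet_mono`, `onionDomain_mono`);
* flip-reflection transport (`mem_kSet_flipReflect_iff`, `mem_onionDomain_flipReflect_iff`):
  `Γ⁺(R∘T σ) = R(Γ⁻(σ))` for the reflection `R` in the horizontal axis.

## References

* H.-O. Georgii, Y. Higuchi, J. Math. Phys. 41 (2000), Lemma 2.3 and its proof (pp. 5–6)
  [GeorgiiHiguchi2000].
-/

noncomputable section

open SimpleGraph Finset
open Literature.Probability.LatticeModels (Site zdGraph zdStarGraph zdGraph_adj_iff zdStarGraph_adj
  zdGraph_le_zdStarGraph reflectCoord reflectCoord_apply reflectCoord_reflectCoord starReflectHom starReflectHom_apply)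

namespace Literature.Probability.Percolation

variable {Λ : Finset (Site 2)} {c : Site 2 → ℤˣ}

/-! ### The random volume -/

section Domain

variable (Λ c)

/-- **`innerReach s`**: the sites of `Λ` reached, inside `Λ`, from a site `∗`-adjacent to the outside
strictly off the `s`-side, by a `∗`-walk whose sites other than the endpoint avoid `kSet s`. [cite: GeorgiiHiguchi2000, Lemma 2.3 (proof)] -/
def innerReach (s : ℤˣ) : Set (Site 2) :=
  {p | p ∈ Λ ∧ ∃ a : Site 2, (∃ z, z ∉ Λ ∧ ¬ OnSide s z ∧ zdStarGraph.Adj a z) ∧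
    ∃ w : zdStarGraph.Walk p a, (∀ v ∈ w.support, v ∈ Λ) ∧ ∀ v ∈ w.support.tail, v ∉ kSet Λ c s}

/-- **The random volume `Γ_s = Λ ∖ innerReach s`** (GH's "largest `Γ ⊂ Λ` containing `x` such that
`∂Γ` forms a `+∗`circuit `+∗`connected to `σ`", for `s = +1`). [cite: GeorgiiHiguchi2000, Lemma 2.3 (proof)] -/
def onionDomain (s : ℤˣ) : Finset (Site 2) :=
  open Classical in Λ.filter fun p => p ∉ innerReach Λ c s

variable {Λ c}

/-- Membership in the random volume. [folklore] -/
theorem mem_onionDomain_iff {s : ℤˣ} {p : Site 2} : p ∈ onionDomain Λ c s ↔ p ∈ Λ ∧ p ∉ innerReach Λ c s := by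
  classical
  rw [onionDomain, Finset.mem_filter]

/-- Sites of `Λ` adjacent to the outside off the `s`-side are reached. [folklore] -/
theorem mem_innerReach_of_adj_out {s : ℤˣ} {p z : Site 2} (hp : p ∈ Λ) (hz : z ∉ Λ) (hside : ¬ OnSide s z)
    (hadj : zdStarGraph.Adj p z) : p ∈ innerReach Λ c s :=
  ⟨hp, p, ⟨z, hz, hside, hadj⟩, Walk.nil, by simp [hp], by simp⟩

/-- Extending the reach by one step from a reached site outside `kSet s`. [folklore] -/
theorem mem_innerReach_of_adj {s : ℤˣ} {p q : Site 2} (hq : q ∈ innerReach Λ c s) (hqK : q ∉ kSet Λ c s)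
    (hp : p ∈ Λ) (hadj : zdStarGraph.Adj p q) : p ∈ innerReach Λ c s := by
  obtain ⟨hqΛ, a, ha, w, hwΛ, hwK⟩ := hq
  refine ⟨hp, a, ha, Walk.cons hadj w, fun v hv => ?_, fun v hv => ?_⟩
  · rw [Walk.support_cons, List.mem_cons] at hv
    rcases hv with rfl | hv
    · exact hp
    · exact hwΛ v hv
  · rw [Walk.support_cons, List.tail_cons] at hv
    rcases (Walk.mem_support_iff w).1 hv with rfl | hv
    · exact hqK
    · exact hwK v hv

/-- **Boundary property inside `Λ`**: a site of `Λ` outside `Γ_s` that is `∗`-adjacent to `Γ_s`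
belongs to `kSet s`. [cite: GeorgiiHiguchi2000, Lemma 2.3 (proof)] -/
theorem mem_kSet_of_adj_onionDomain {s : ℤˣ} {g w : Site 2} (hg : g ∈ onionDomain Λ c s) (hw : w ∈ Λ)
    (hwΓ : w ∉ onionDomain Λ c s) (hadj : zdStarGraph.Adj g w) : w ∈ kSet Λ c s := by
  rw [mem_onionDomain_iff] at hg hwΓ
  by_contra hwK
  have hwR : w ∈ innerReach Λ c s := by
    by_contra h; exact hwΓ ⟨hw, h⟩
  exact hg.2 (mem_innerReach_of_adj hwR hwK hg.1 hadj)

/-- **Boundary property outside `Λ`**: an outside `∗`-neighbour of `Γ_s` is on the `s`-side. [cite: GeorgiiHiguchi2000, Lemma 2.3 (proof)] -/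
theorem onSide_of_adj_onionDomain {s : ℤˣ} {g z : Site 2} (hg : g ∈ onionDomain Λ c s) (hz : z ∉ Λ)
    (hadj : zdStarGraph.Adj g z) : OnSide s z := by
  rw [mem_onionDomain_iff] at hg
  by_contra hside
  exact hg.2 (mem_innerReach_of_adj_out hg.1 hz hside hadj)

/-- For `x ∈ Λ ∖ kSet s`: `x ∈ xSet s ↔ x ∈ innerReach s`. [folklore] -/
theorem mem_xSet_iff_mem_innerReach {s : ℤˣ} {x : Site 2} (hx : x ∈ Λ) (hxK : x ∉ kSet Λ c s) :
    x ∈ xSet Λ c s ↔ x ∈ innerReach Λ c s := by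
  constructor
  · rintro ⟨-, -, q, hq, hr⟩
    obtain ⟨w, hw⟩ := exists_starWalk_of_reachable hr ⟨Finset.mem_coe.2 hx, hxK⟩
    exact ⟨hx, q, hq, w, fun v hv => Finset.mem_coe.1 (hw v hv).1, fun v hv => (hw v (List.mem_of_mem_tail hv)).2⟩
  · rintro ⟨-, a, ha, w, hwΛ, hwK⟩
    refine ⟨hx, hxK, a, ha, siteOpenGraph_reachable_of_walk' w fun v hv => ?_⟩
    refine ⟨Finset.mem_coe.2 (hwΛ v hv), ?_⟩
    rcases (Walk.mem_support_iff w).1 hv with rfl | hv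
    · exact hxK
    · exact hwK v hv
where
  /-- local copy of the walk-to-reachability bridge -/
  siteOpenGraph_reachable_of_walk' {O : Set (Site 2)} {u v : Site 2} (p : zdStarGraph.Walk u v)
      (hp : ∀ z ∈ p.support, z ∈ O) : (siteOpenGraph zdStarGraph O).Reachable u v := by
    refine ⟨p.transfer (siteOpenGraph zdStarGraph O) fun e he => ?_⟩
    induction e using Sym2.ind with
    | h a b =>
      rw [mem_edgeSet, siteOpenGraph_adj]
      exact ⟨Walk.adj_of_mem_edges _ he, hp a (Walk.fst_mem_support_of_mem_edges _ he),
        hp b (Walk.snd_mem_support_of_mem_edges _ he)⟩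

/-- For `x ∈ Λ`: `x ∉ xSet s ↔ x ∈ kSet s ∨ x ∈ Γ_s`. [cite: GeorgiiHiguchi2000, Lemma 2.3 (proof)] -/
theorem not_mem_xSet_iff {s : ℤˣ} {x : Site 2} (hx : x ∈ Λ) :
    x ∉ xSet Λ c s ↔ x ∈ kSet Λ c s ∨ x ∈ onionDomain Λ c s := by
  rw [mem_onionDomain_iff]
  by_cases hxK : x ∈ kSet Λ c s
  · simp only [hxK, true_or, iff_true]
    rintro ⟨-, h, -⟩; exact h hxK
  · rw [mem_xSet_iff_mem_innerReach hx hxK]; tauto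

/-- **The onion dichotomy, volume form**: `x ∈ kSet 1 ∨ x ∈ kSet (-1) ∨ x ∈ Γ⁺ ∨ x ∈ Γ⁻`. [cite: GeorgiiHiguchi2000, Lemma 2.3 (proof, claim (1))] -/
theorem onion_dichotomy' (hHF : ∀ z ∉ Λ, FarRight ↑Λ z) (hcpos : ∀ z ∉ Λ, 0 ≤ z 1 → c z = 1)
    (hcneg : ∀ z ∉ Λ, z 1 < 0 → c z = -1) {x : Site 2} (hx : x ∈ Λ) :
    x ∈ kSet Λ c 1 ∨ x ∈ kSet Λ c (-1) ∨ x ∈ onionDomain Λ c 1 ∨ x ∈ onionDomain Λ c (-1) := by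
  rcases onion_dichotomy hHF hcpos hcneg hx with h | h | h | h
  · exact Or.inl h
  · exact Or.inr (Or.inl h)
  · rcases (not_mem_xSet_iff hx).1 h with h | h
    · exact Or.inl h
    · exact Or.inr (Or.inr (Or.inl h))
  · rcases (not_mem_xSet_iff hx).1 h with h | h
    · exact Or.inr (Or.inl h)
    · exact Or.inr (Or.inr (Or.inr h))

end Domain

/-! ### Monotonicity in the colouring -/

section Mono

variable {c c' : Site 2 → ℤˣ} {s : ℤˣ}

/-- `kSet s` grows when `s`-sites are added. [folklore] -/
theorem kSet_mono (h : ∀ v, c v = s → c' v = s) : kSet Λ c s ⊆ kSet Λ c' s := by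
  rintro p ⟨hp, hcp, q, hq, hr⟩
  refine ⟨hp, h p hcp, q, hq, hr.mono ?_⟩
  intro a b hab
  rw [sGraph, siteOpenGraph_adj] at hab ⊢
  exact ⟨hab.1, ⟨h a hab.2.1.1, hab.2.1.2⟩, ⟨h b hab.2.2.1, hab.2.2.2⟩⟩

/-- `innerReach s` shrinks when `s`-sites are added. [folklore] -/
theorem innerReach_anti (h : ∀ v, c v = s → c' v = s) : innerReach Λ c' s ⊆ innerReach Λ c s := by
  rintro p ⟨hp, a, ha, w, hwΛ, hwK⟩
  exact ⟨hp, a, ha, w, hwΛ, fun v hv hvK => hwK v hv (kSet_mono h hvK)⟩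

/-- `Γ_s` grows when `s`-sites are added. [folklore] -/
theorem onionDomain_mono (h : ∀ v, c v = s → c' v = s) : onionDomain Λ c s ⊆ onionDomain Λ c' s := by
  intro p hp
  rw [mem_onionDomain_iff] at hp ⊢
  exact ⟨hp.1, fun h' => hp.2 (innerReach_anti h h')⟩

/-- `kSet` depends only on the colours in `Λ`. [folklore] -/
theorem kSet_eq_of_eqOn (h : ∀ v ∈ Λ, c v = c' v) (s : ℤˣ) : kSet Λ c s = kSet Λ c' s := by
  have key : ∀ {c c' : Site 2 → ℤˣ}, (∀ v ∈ Λ, c v = c' v) → kSet Λ c s ⊆ kSet Λ c' s := by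
    intro c c' h p hp
    obtain ⟨hpΛ, hcp, q, hq, hr⟩ := hp
    refine ⟨hpΛ, by rw [← h p hpΛ]; exact hcp, q, hq, hr.mono ?_⟩
    intro a b hab
    rw [sGraph, siteOpenGraph_adj] at hab ⊢
    obtain ⟨hadj, ⟨hca, haΛ⟩, ⟨hcb, hbΛ⟩⟩ := hab
    exact ⟨hadj, ⟨by rw [Set.mem_setOf_eq, ← h a (Finset.mem_coe.1 haΛ)]; exact hca, haΛ⟩,
      ⟨by rw [Set.mem_setOf_eq, ← h b (Finset.mem_coe.1 hbΛ)]; exact hcb, hbΛ⟩⟩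
  exact Set.Subset.antisymm (key h) (key fun v hv => (h v hv).symm)

/-- The random volume depends only on the colours in `Λ`. [folklore] -/
theorem onionDomain_eq_of_eqOn (h : ∀ v ∈ Λ, c v = c' v) (s : ℤˣ) : onionDomain Λ c s = onionDomain Λ c' s := by
  have hX : innerReach Λ c s = innerReach Λ c' s := by
    ext p; simp only [innerReach, Set.mem_setOf_eq, kSet_eq_of_eqOn h s]
  ext p
  rw [mem_onionDomain_iff, mem_onionDomain_iff, hX]

end Mono

/-! ### Flip-reflection transport -/

section Transport

/-- The reflection in the horizontal axis. [folklore] -/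
abbrev Rf : Site 2 → Site 2 := reflectCoord 1

/-- Coordinates of the reflection. [folklore] -/
theorem Rf_apply_zero (z : Site 2) : Rf z 0 = z 0 := by simp [reflectCoord_apply]
/-- Coordinates of the reflection. [folklore] -/
theorem Rf_apply_one (z : Site 2) : Rf z 1 = -z 1 := by simp [reflectCoord_apply]
/-- The reflection is an involution. [folklore] -/
theorem Rf_Rf (z : Site 2) : Rf (Rf z) = z := reflectCoord_reflectCoord 1 z

/-- The reflection preserves `∗`-adjacency. [folklore] -/
theorem Rf_adj {a b : Site 2} (h : zdStarGraph.Adj a b) : zdStarGraph.Adj (Rf a) (Rf b) :=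
  (starReflectHom 1).map_rel h

/-- The flip-reflected colouring `(R∘T)(c) = -c ∘ R`. [cite: GeorgiiHiguchi2000, Lemma 2.2] -/
def flipReflectColour (c : Site 2 → ℤˣ) : Site 2 → ℤˣ := fun z => -c (Rf z)

/-- `R∘T` is an involution on colourings. [folklore] -/
theorem flipReflectColour_flipReflectColour (c : Site 2 → ℤˣ) : flipReflectColour (flipReflectColour c) = c := by
  funext z; simp [flipReflectColour, Rf_Rf]

/-- The side condition transforms: `OnSide s z ↔ OnSide (-s) (R z)`. [folklore] -/
theorem onSide_Rf_iff (s : ℤˣ) (z : Site 2) : OnSide (-s) (Rf z) ↔ OnSide s z := by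
  unfold OnSide; rw [Rf_apply_one, Units.val_neg]; constructor <;> intro h <;> nlinarith

/-- The vertices of a reflected walk. [folklore] -/
theorem mem_support_map_starReflect {u v : Site 2} :
    ∀ (w : zdStarGraph.Walk u v) (z : Site 2), z ∈ (w.map (starReflectHom 1)).support → ∃ y ∈ w.support, z = Rf y
  | Walk.nil, z, hz => by
    simp only [Walk.map_nil, Walk.support_nil, List.mem_singleton] at hz
    exact ⟨u, by simp, hz⟩
  | Walk.cons h w', z, hz => by
    simp only [Walk.map_cons, Walk.support_cons, List.mem_cons] at hz
    rcases hz with rfl | hz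
    · exact ⟨u, by simp, rfl⟩
    · obtain ⟨y, hy, rfl⟩ := mem_support_map_starReflect w' z hz
      exact ⟨y, by rw [Walk.support_cons]; exact List.mem_cons_of_mem _ hy, rfl⟩

/-- The vertices after the first of a reflected walk. [folklore] -/
theorem mem_support_tail_map_starReflect {u v : Site 2} :
    ∀ (w : zdStarGraph.Walk u v) (z : Site 2), z ∈ (w.map (starReflectHom 1)).support.tail → ∃ y ∈ w.support.tail, z = Rf y
  | Walk.nil, z, hz => by simp at hz
  | Walk.cons h w', z, hz => by
    simp only [Walk.map_cons, Walk.support_cons, List.tail_cons] at hz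
    obtain ⟨y, hy, rfl⟩ := mem_support_map_starReflect w' z hz
    exact ⟨y, by rw [Walk.support_cons, List.tail_cons]; exact hy, rfl⟩

variable (hΛ : ∀ z, z ∈ Λ ↔ Rf z ∈ Λ)
include hΛ

/-- **Transport of `kSet`**: `p ∈ kSet (R∘T c) s ↔ R p ∈ kSet c (-s)`, one direction. [cite: GeorgiiHiguchi2000, Lemma 2.3 (proof)] -/
theorem Rf_mem_kSet_of_mem {s : ℤˣ} {p : Site 2} (hp : p ∈ kSet Λ (flipReflectColour c) s) :
    Rf p ∈ kSet Λ c (-s) := by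
  obtain ⟨hpΛ, hcp, q, ⟨z, hz, hside, hqz⟩, hr⟩ := hp
  refine ⟨(hΛ p).1 hpΛ, ?_, Rf q, ⟨Rf z, fun h => hz ((hΛ z).2 h), (onSide_Rf_iff s z).2 hside, Rf_adj hqz⟩, ?_⟩
  · simp only [flipReflectColour] at hcp
    show c (Rf p) = -s
    rw [← hcp, neg_neg]
  · -- map the `s`-path by `R`
    refine hr.map (G' := sGraph Λ c (-s)) ⟨Rf, fun {a b} hab => ?_⟩
    rw [sGraph, siteOpenGraph_adj] at hab ⊢
    obtain ⟨hadj, ⟨hca, haΛ⟩, ⟨hcb, hbΛ⟩⟩ := hab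
    simp only [flipReflectColour, Set.mem_setOf_eq] at hca hcb
    exact ⟨Rf_adj hadj, ⟨show c (Rf a) = -s by rw [← hca, neg_neg], Finset.mem_coe.2 ((hΛ a).1 haΛ)⟩,
      ⟨show c (Rf b) = -s by rw [← hcb, neg_neg], Finset.mem_coe.2 ((hΛ b).1 hbΛ)⟩⟩

/-- **Transport of `kSet`**, equivalence form. [cite: GeorgiiHiguchi2000, Lemma 2.3 (proof)] -/
theorem mem_kSet_flipReflect_iff {s : ℤˣ} {p : Site 2} :
    p ∈ kSet Λ (flipReflectColour c) s ↔ Rf p ∈ kSet Λ c (-s) := by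
  refine ⟨Rf_mem_kSet_of_mem hΛ, fun h => ?_⟩
  have h' : Rf p ∈ kSet Λ (flipReflectColour (flipReflectColour c)) (-s) := by
    rw [flipReflectColour_flipReflectColour]; exact h
  have := Rf_mem_kSet_of_mem (c := flipReflectColour c) hΛ h'
  rwa [Rf_Rf, neg_neg] at this

/-- **Transport of `innerReach`**, one direction. [cite: GeorgiiHiguchi2000, Lemma 2.3 (proof)] -/
theorem Rf_mem_innerReach_of_mem {s : ℤˣ} {p : Site 2} (hp : p ∈ innerReach Λ (flipReflectColour c) s) :
    Rf p ∈ innerReach Λ c (-s) := by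
  obtain ⟨hpΛ, a, ⟨z, hz, hside, haz⟩, w, hwΛ, hwK⟩ := hp
  refine ⟨(hΛ p).1 hpΛ, Rf a, ⟨Rf z, fun h => hz ((hΛ z).2 h), fun h => hside ((onSide_Rf_iff s z).1 h), Rf_adj haz⟩,
    w.map (starReflectHom 1), fun v hv => ?_, fun v hv => ?_⟩
  · obtain ⟨u, hu, rfl⟩ := mem_support_map_starReflect w v hv
    exact (hΛ u).1 (hwΛ u hu)
  · obtain ⟨u, hu, rfl⟩ := mem_support_tail_map_starReflect w v hv
    intro hK
    refine hwK u hu ((mem_kSet_flipReflect_iff hΛ).2 ?_)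
    simpa using hK

/-- **Transport of the random volume**: `p ∈ Γ_s(R∘T c) ↔ R p ∈ Γ_{-s}(c)`. [cite: GeorgiiHiguchi2000, Lemma 2.3 (proof)] -/
theorem mem_onionDomain_flipReflect_iff {s : ℤˣ} {p : Site 2} :
    p ∈ onionDomain Λ (flipReflectColour c) s ↔ Rf p ∈ onionDomain Λ c (-s) := by
  rw [mem_onionDomain_iff, mem_onionDomain_iff, ← hΛ p]
  refine and_congr Iff.rfl (not_congr ⟨Rf_mem_innerReach_of_mem hΛ, fun h => ?_⟩)
  have h' : Rf p ∈ innerReach Λ (flipReflectColour (flipReflectColour c)) (-s) := by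
    rw [flipReflectColour_flipReflectColour]; exact h
  have := Rf_mem_innerReach_of_mem (c := flipReflectColour c) hΛ h'
  rwa [Rf_Rf, neg_neg] at this

end Transport

/-! ### Determination from outside (`s = +1`) -/

section Outside

/-- Splitting a walk at its first vertex in a set `S` (the start being outside `S`). [folklore] -/
theorem exists_split_first_mem {S : Set (Site 2)} :
    ∀ {u t : Site 2} (W : zdStarGraph.Walk u t), u ∉ S → (∃ y ∈ W.support, y ∈ S) →
      ∃ (a g : Site 2) (W₀ : zdStarGraph.Walk u a), zdStarGraph.Adj a g ∧ g ∈ S ∧ g ∈ W.support ∧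
        (∀ y ∈ W₀.support, y ∉ S) ∧ (∀ y ∈ W₀.support, y ∈ W.support)
  | _, _, Walk.nil, hu, ⟨y, hy, hyS⟩ => by
    rw [Walk.support_nil, List.mem_singleton] at hy; subst hy; exact absurd hyS hu
  | u, t, Walk.cons (v := u') hadj W', hu, hex => by
    by_cases hu' : u' ∈ S
    · exact ⟨u, u', Walk.nil, hadj, hu', by simp, fun y hy => by
        rw [Walk.support_nil, List.mem_singleton] at hy; exact hy ▸ hu, fun y hy => by
        rw [Walk.support_nil, List.mem_singleton] at hy; subst hy; simp⟩
    · have hex' : ∃ y ∈ W'.support, y ∈ S := by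
        obtain ⟨y, hy, hyS⟩ := hex
        rw [Walk.support_cons, List.mem_cons] at hy
        rcases hy with rfl | hy
        · exact absurd hyS hu
        · exact ⟨y, hy, hyS⟩
      obtain ⟨a, g, W₀, hag, hg, hgW, h1, h2⟩ := exists_split_first_mem W' hu' hex'
      refine ⟨a, g, Walk.cons hadj W₀, hag, hg, ?_, fun y hy => ?_, fun y hy => ?_⟩
      · rw [Walk.support_cons]; exact List.mem_cons_of_mem _ hgW
      · rw [Walk.support_cons, List.mem_cons] at hy
        rcases hy with rfl | hy
        · exact hu
        · exact h1 y hy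
      · rw [Walk.support_cons, List.mem_cons] at hy ⊢
        rcases hy with rfl | hy
        · exact Or.inl rfl
        · exact Or.inr (h2 y hy)

/-- Splitting a walk from a far-reaching start before its first vertex that does not reach far: the
prefix reaches far throughout and ends `∗`-adjacent to a site of the avoided set. [folklore] -/
theorem exists_split_first_not_far {A : Set (Site 2)} :
    ∀ {t u : Site 2} (W : zdStarGraph.Walk t u), FarRight A t → (∃ y ∈ W.support, ¬ FarRight A y) →
      ∃ (e g : Site 2) (W₁ : zdStarGraph.Walk t e), zdStarGraph.Adj e g ∧ g ∈ A ∧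
        (∀ y ∈ W₁.support, FarRight A y) ∧ (∀ y ∈ W₁.support, y ∈ W.support)
  | _, _, Walk.nil, ht, ⟨y, hy, hyf⟩ => by
    rw [Walk.support_nil, List.mem_singleton] at hy; subst hy; exact absurd ht hyf
  | t, u, Walk.cons (v := t') hadj W', ht, hu => by
    by_cases ht' : FarRight A t'
    · have hu' : ∃ y ∈ W'.support, ¬ FarRight A y := by
        obtain ⟨y, hy, hyf⟩ := hu
        rw [Walk.support_cons, List.mem_cons] at hy
        rcases hy with rfl | hy
        · exact absurd ht hyf
        · exact ⟨y, hy, hyf⟩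
      obtain ⟨e, g, W₁, heg, hg, h1, h2⟩ := exists_split_first_not_far W' ht' hu'
      refine ⟨e, g, Walk.cons hadj W₁, heg, hg, fun y hy => ?_, fun y hy => ?_⟩
      · rw [Walk.support_cons, List.mem_cons] at hy
        rcases hy with rfl | hy
        · exact ht
        · exact h1 y hy
      · rw [Walk.support_cons, List.mem_cons] at hy ⊢
        rcases hy with rfl | hy
        · exact Or.inl rfl
        · exact Or.inr (h2 y hy)
    · have ht'A : t' ∈ A := by
        by_contra h; exact ht' (ht.of_adj hadj.symm h)
      exact ⟨t, t', Walk.nil, hadj, ht'A, fun y hy => by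
        rw [Walk.support_nil, List.mem_singleton] at hy; exact hy ▸ ht, fun y hy => by
        rw [Walk.support_nil, List.mem_singleton] at hy; subst hy; simp⟩

/-- All vertices of an `innerReach` walk lie in `innerReach`. [folklore] -/
theorem mem_innerReach_of_walk {s : ℤˣ} {a : Site 2} (ha : ∃ z, z ∉ Λ ∧ ¬ OnSide s z ∧ zdStarGraph.Adj a z) :
    ∀ {p : Site 2} (w : zdStarGraph.Walk p a), (∀ v ∈ w.support, v ∈ Λ) → (∀ v ∈ w.support.tail, v ∉ kSet Λ c s) →
      ∀ v ∈ w.support, v ∈ innerReach Λ c s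
  | p, Walk.nil, hΛ, _, v, hv => by
    rw [Walk.support_nil, List.mem_singleton] at hv; subst hv
    exact ⟨hΛ _ (by simp), _, ha, Walk.nil, hΛ, by simp⟩
  | p, Walk.cons (v := p') hadj w', hΛ, hK, v, hv => by
    have hΛ' : ∀ y ∈ w'.support, y ∈ Λ := fun y hy => hΛ y (by rw [Walk.support_cons]; exact List.mem_cons_of_mem _ hy)
    have hK' : ∀ y ∈ w'.support.tail, y ∉ kSet Λ c s := fun y hy =>
      hK y (by rw [Walk.support_cons, List.tail_cons]; exact List.mem_of_mem_tail hy)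
    rw [Walk.support_cons, List.mem_cons] at hv
    rcases hv with rfl | hv
    · exact ⟨hΛ _ (by simp), _, ha, Walk.cons hadj w', hΛ, hK⟩
    · exact mem_innerReach_of_walk ha w' hΛ' hK' v hv

/-- A `σ'`-plus walk in `Λ` from `u ∉ Γ⁺(σ)` to a witness shows `u ∈ kSet(σ)` when `σ' = σ` off
`Γ⁺(σ)` (cut at the first entry into `Γ⁺(σ)`, whose predecessor is a crust site). [folklore] -/
theorem mem_kSet_of_plus_walk_off {c' : Site 2 → ℤˣ} (hagree : ∀ v, v ∉ onionDomain Λ c 1 → c' v = c v) :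
    ∀ {u q : Site 2} (W : zdStarGraph.Walk u q), (∀ v ∈ W.support, c' v = 1 ∧ v ∈ Λ) → u ∉ onionDomain Λ c 1 →
      (∃ z, z ∉ Λ ∧ OnSide 1 z ∧ zdStarGraph.Adj q z) → u ∈ kSet Λ c 1
  | u, _, Walk.nil, hW, hu, ⟨z, hz, hside, hadj⟩ => by
    have hu' := hW u (by simp)
    exact mem_kSet_of_adj hu'.2 (by rw [← hagree _ hu]; exact hu'.1) hz hside hadj
  | u, q, Walk.cons (v := u') hadj W', hW, hu, hq => by
    have huΛ : u ∈ Λ := (hW u (by simp)).2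
    have hcu : c u = 1 := by rw [← hagree _ hu]; exact (hW u (by simp)).1
    by_cases hu' : u' ∈ onionDomain Λ c 1
    · exact mem_kSet_of_adj_onionDomain hu' huΛ hu hadj.symm
    · have hu'K := mem_kSet_of_plus_walk_off hagree W'
        (fun v hv => hW v (by rw [Walk.support_cons]; exact List.mem_cons_of_mem _ hv)) hu' hq
      refine mem_kSet_of_reachable hu'K huΛ hcu (Adj.reachable ?_)
      rw [sGraph, siteOpenGraph_adj]
      exact ⟨hadj, ⟨hcu, Finset.mem_coe.2 huΛ⟩, ⟨hu'K.2.1, Finset.mem_coe.2 hu'K.1⟩⟩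

/-- **`kSet` from outside, easy inclusion**: for `σ' = σ` off `Γ = Γ⁺(σ)`,
`kSet(σ') ∖ Γ ⊆ kSet(σ)`. [cite: GeorgiiHiguchi2000, Lemma 2.3 (proof)] -/
theorem mem_kSet_of_mem_kSet_off {c' : Site 2 → ℤˣ} (hagree : ∀ v, v ∉ onionDomain Λ c 1 → c' v = c v)
    {w : Site 2} (hw : w ∈ kSet Λ c' 1) (hwG : w ∉ onionDomain Λ c 1) : w ∈ kSet Λ c 1 := by
  obtain ⟨hwΛ, hcw, q, hq, hr⟩ := hw
  obtain ⟨W, hW⟩ := exists_starWalk_of_reachable hr ⟨hcw, Finset.mem_coe.2 hwΛ⟩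
  exact mem_kSet_of_plus_walk_off hagree W (fun v hv => ⟨(hW v hv).1, Finset.mem_coe.1 (hW v hv).2⟩) hwG hq

/-- Along an `innerReach(σ')` walk ending outside `Γ⁺(σ)`: no vertex lies in `Γ⁺(σ)` and the tail
avoids `kSet(σ)`, provided `kSet(σ) ∖ Γ ⊆ kSet(σ')`. [folklore] -/
theorem innerReach_walk_off {c' : Site 2 → ℤˣ}
    (hKK' : ∀ w, w ∈ kSet Λ c 1 → w ∉ onionDomain Λ c 1 → w ∈ kSet Λ c' 1) :
    ∀ {u a₀ : Site 2} (wk : zdStarGraph.Walk u a₀), a₀ ∉ onionDomain Λ c 1 → (∀ v ∈ wk.support, v ∈ Λ) →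
      (∀ v ∈ wk.support.tail, v ∉ kSet Λ c' 1) →
      (∀ v ∈ wk.support, v ∉ onionDomain Λ c 1) ∧ (∀ v ∈ wk.support.tail, v ∉ kSet Λ c 1)
  | _, _, Walk.nil, ha₀G, _, _ =>
    ⟨fun v hv => by rw [Walk.support_nil, List.mem_singleton] at hv; exact hv ▸ ha₀G, by simp⟩
  | u, a₀, Walk.cons (v := u') hadj wk', ha₀G, hΛ, hK' => by
    have hΛ' : ∀ v ∈ wk'.support, v ∈ Λ := fun v hv => hΛ v (by rw [Walk.support_cons]; exact List.mem_cons_of_mem _ hv)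
    have hK'' : ∀ v ∈ wk'.support.tail, v ∉ kSet Λ c' 1 := fun v hv =>
      hK' v (by rw [Walk.support_cons, List.tail_cons]; exact List.mem_of_mem_tail hv)
    obtain ⟨ihG, ihK⟩ := innerReach_walk_off hKK' wk' ha₀G hΛ' hK''
    have hu'G : u' ∉ onionDomain Λ c 1 := ihG u' (Walk.start_mem_support wk')
    have hu'Λ : u' ∈ Λ := hΛ' u' (Walk.start_mem_support wk')
    have hu'tail : u' ∈ (Walk.cons hadj wk').support.tail := by
      rw [Walk.support_cons, List.tail_cons]; exact Walk.start_mem_support wk'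
    have hu'K : u' ∉ kSet Λ c 1 := fun h => hK' u' hu'tail (hKK' u' h hu'G)
    refine ⟨fun v hv => ?_, fun v hv => ?_⟩
    · rw [Walk.support_cons, List.mem_cons] at hv
      rcases hv with rfl | hv
      · intro hvG
        exact hu'K (mem_kSet_of_adj_onionDomain hvG hu'Λ hu'G hadj)
      · exact ihG v hv
    · rw [Walk.support_cons, List.tail_cons] at hv
      rcases (Walk.mem_support_iff wk').1 hv with rfl | hv
      · exact hu'K
      · exact ihK v hv

variable (hcpos : ∀ z ∉ Λ, 0 ≤ z 1 → c z = 1) (hcneg : ∀ z ∉ Λ, z 1 < 0 → c z = -1)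
include hcpos hcneg

/-- A `σ`-plus walk avoiding `Γ⁺(σ)` from `v ∈ Λ`, possibly leaving `Λ`, ending at a witness or
outside, shows `v ∈ kSet(σ')` for `σ' = σ` off `Γ⁺(σ)`. [folklore] -/
theorem mem_kSet_off_of_walk_avoiding {c' : Site 2 → ℤˣ} (hagree : ∀ v, v ∉ onionDomain Λ c 1 → c' v = c v) :
    ∀ {v t : Site 2} (π : zdStarGraph.Walk v t), v ∈ Λ → (∀ y ∈ π.support, c y = 1) →
      (∀ y ∈ π.support, y ∉ onionDomain Λ c 1) → (t ∉ Λ ∨ ∃ z, z ∉ Λ ∧ OnSide 1 z ∧ zdStarGraph.Adj t z) →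
      v ∈ kSet Λ c' 1
  | v, _, Walk.nil, hv, hc, hG, ht => by
    rcases ht with ht | ⟨z, hz, hside, hadj⟩
    · exact absurd hv ht
    · have hcv : c' v = 1 := by rw [hagree v (hG v (by simp))]; exact hc v (by simp)
      exact mem_kSet_of_adj hv hcv hz hside hadj
  | v, t, Walk.cons (v := v') hadj π', hv, hc, hG, ht => by
    have hcv : c' v = 1 := by rw [hagree v (hG v (by simp))]; exact hc v (by simp)
    by_cases hv'Λ : v' ∈ Λ
    · have hv'K := mem_kSet_off_of_walk_avoiding hagree π' hv'Λ
        (fun y hy => hc y (by rw [Walk.support_cons]; exact List.mem_cons_of_mem _ hy))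
        (fun y hy => hG y (by rw [Walk.support_cons]; exact List.mem_cons_of_mem _ hy)) ht
      refine mem_kSet_of_reachable hv'K hv hcv (Adj.reachable ?_)
      rw [sGraph, siteOpenGraph_adj]
      exact ⟨hadj, ⟨hcv, Finset.mem_coe.2 hv⟩, ⟨hv'K.2.1, Finset.mem_coe.2 hv'K.1⟩⟩
    · have hcv' : c v' = 1 := hc v' (by simp)
      exact mem_kSet_of_adj hv hcv hv'Λ (onSide_of_colour hcpos hcneg hv'Λ hcv') hadj

variable (hHF : ∀ z ∉ Λ, FarRight ↑Λ z)
include hHF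

/-- **`kSet` from outside, hard inclusion**: for `σ' = σ` off `Γ = Γ⁺(σ)`, every site of
`kSet(σ) ∖ Γ` is in `kSet(σ')` — its witness path can be rerouted around `Γ` along the outer
`∗`-boundaries of the components of `Γ` it meets (`exists_starWalk_starBoundary`). [cite: GeorgiiHiguchi2000, Lemma 2.3 (proof)] -/
theorem mem_kSet_off_of_mem_kSet {c' : Site 2 → ℤˣ} (hagree : ∀ v, v ∉ onionDomain Λ c 1 → c' v = c v)
    {w : Site 2} (hw : w ∈ kSet Λ c 1) (hwG : w ∉ onionDomain Λ c 1) : w ∈ kSet Λ c' 1 := by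
  classical
  set G := onionDomain Λ c 1 with hGdef
  have hGΛ : G ⊆ Λ := fun g hg => (mem_onionDomain_iff.1 hg).1
  have hXmem : ∀ v, v ∈ Λ → v ∉ G → v ∈ innerReach Λ c 1 := fun v hv hvG => by
    by_contra h; exact hvG (mem_onionDomain_iff.2 ⟨hv, h⟩)
  have hcrust : ∀ v g, v ∈ Λ → v ∉ G → g ∈ G → zdStarGraph.Adj g v → v ∈ kSet Λ c 1 :=
    fun v g hv hvG hg hadj => mem_kSet_of_adj_onionDomain hg hv hvG hadj
  have hout : ∀ g z, g ∈ G → z ∉ Λ → zdStarGraph.Adj g z → 0 ≤ z 1 := by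
    intro g z hg hz hadj
    have := onSide_of_adj_onionDomain hg hz hadj
    unfold OnSide at this; simpa using this
  -- the claim, by induction on the number of `Γ`-sites joined inside `Γ` to the witness walk
  suffices main : ∀ (n : ℕ) (v t : Site 2) (π : zdStarGraph.Walk v t),
      #(G.filter fun g => ∃ u ∈ π.support, u ∈ G ∧ (siteOpenGraph zdStarGraph (↑G : Set (Site 2))).Reachable g u) ≤ n →
      (∀ y ∈ π.support, y ∈ Λ ∧ c y = 1) → v ∉ G → (∃ z, z ∉ Λ ∧ OnSide 1 z ∧ zdStarGraph.Adj t z) →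
      v ∈ kSet Λ c' 1 by
    obtain ⟨hwΛ, hcw, q, hq, hr⟩ := hw
    obtain ⟨π, hπ⟩ := exists_starWalk_of_reachable hr ⟨hcw, Finset.mem_coe.2 hwΛ⟩
    exact main _ w q π le_rfl (fun y hy => ⟨Finset.mem_coe.1 (hπ y hy).2, (hπ y hy).1⟩) hwG hq
  intro n
  induction n with
  | zero =>
    intro v t π hN hπ hv ht
    refine mem_kSet_off_of_walk_avoiding hcpos hcneg hagree π (hπ v (Walk.start_mem_support π)).1
      (fun y hy => (hπ y hy).2) (fun y hy hyG => ?_) (Or.inr ht)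
    have : y ∈ G.filter fun g => ∃ u ∈ π.support, u ∈ G ∧ (siteOpenGraph zdStarGraph (↑G : Set (Site 2))).Reachable g u :=
      Finset.mem_filter.2 ⟨hyG, y, hy, hyG, Reachable.refl _⟩
    rw [Nat.le_zero, Finset.card_eq_zero] at hN
    rw [hN] at this; simp at this
  | succ n ih =>
    intro v t π hN hπ hv ht
    by_cases hmeet : ∃ y ∈ π.support, y ∈ (↑G : Set (Site 2))
    swap
    · push Not at hmeet
      exact mem_kSet_off_of_walk_avoiding hcpos hcneg hagree π (hπ v (Walk.start_mem_support π)).1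
        (fun y hy => (hπ y hy).2) (fun y hy h => hmeet y hy (Finset.mem_coe.2 h)) (Or.inr ht)
    -- first entry into `Γ`
    obtain ⟨a, g, W₀, hag, hg, hgπ, hW₀G, hW₀π⟩ := exists_split_first_mem π (fun h => hv (Finset.mem_coe.1 h)) hmeet
    have hg : g ∈ G := Finset.mem_coe.1 hg
    have haπ : a ∈ π.support := hW₀π a (Walk.end_mem_support W₀)
    have haΛ : a ∈ Λ := (hπ a haπ).1
    have haG : a ∉ G := fun h => hW₀G a (Walk.end_mem_support W₀) (Finset.mem_coe.2 h)
    -- the component `C₀` of `g` in `Γ` and its outer boundary `D₀`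
    set C₀ : Finset (Site 2) := G.filter fun h => (siteOpenGraph zdStarGraph (↑G : Set (Site 2))).Reachable g h with hC₀
    have hmemC₀ : ∀ h, h ∈ C₀ ↔ h ∈ G ∧ (siteOpenGraph zdStarGraph (↑G : Set (Site 2))).Reachable g h := fun h => by
      rw [hC₀, Finset.mem_filter]
    have hgC₀ : g ∈ C₀ := (hmemC₀ g).2 ⟨hg, Reachable.refl _⟩
    have hC₀G : C₀ ⊆ G := Finset.filter_subset _ _
    have hC₀cl : ∀ h ∈ C₀, ∀ h' ∈ G, zdStarGraph.Adj h h' → h' ∈ C₀ := by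
      intro h hh h' hh' hadj
      obtain ⟨hhG, hr⟩ := (hmemC₀ h).1 hh
      refine (hmemC₀ h').2 ⟨hh', hr.trans (Adj.reachable ?_)⟩
      rw [siteOpenGraph_adj]; exact ⟨hadj, Finset.mem_coe.2 hhG, Finset.mem_coe.2 hh'⟩
    have hC₀conn : ∀ a₁ ∈ C₀, ∀ b₁ ∈ C₀, ∃ wk : zdStarGraph.Walk a₁ b₁, ∀ z ∈ wk.support, z ∈ C₀ := by
      intro a₁ ha₁ b₁ hb₁
      obtain ⟨-, hra⟩ := (hmemC₀ a₁).1 ha₁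
      obtain ⟨-, hrb⟩ := (hmemC₀ b₁).1 hb₁
      obtain ⟨P⟩ := hra.symm.trans hrb
      refine ⟨P.mapLe (fun u v huv => ((siteOpenGraph_adj _ _ _ _).1 huv).1), fun z hz => ?_⟩
      rw [Walk.support_mapLe_eq_support] at hz
      have hzG := support_subset_of_siteOpenGraph_walk P (Finset.mem_coe.2 (hC₀G ha₁)) z hz
      exact (hmemC₀ z).2 ⟨Finset.mem_coe.1 hzG, hra.trans (reachable_of_mem_support_open P hz)⟩
    set D₀ : Set (Site 2) := {u | FarRight ↑C₀ u ∧ ∃ h ∈ C₀, zdStarGraph.Adj h u} with hD₀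
    -- far-reaching from outside sites and from `innerReach` sites
    have hfar_out : ∀ z, z ∉ Λ → FarRight ↑C₀ z := fun z hz =>
      (hHF z hz).mono (Finset.coe_subset.2 (hC₀G.trans hGΛ))
    have hfar_X : ∀ p, p ∈ Λ → p ∉ G → FarRight ↑C₀ p := by
      intro p hp hpG
      obtain ⟨-, a₀, ⟨z₀, hz₀, hside₀, haz₀⟩, wk, hwkΛ, hwkK⟩ := hXmem p hp hpG
      have hall := mem_innerReach_of_walk (c := c) ⟨z₀, hz₀, hside₀, haz₀⟩ wk hwkΛ hwkK
      have ha₀far : FarRight ↑C₀ a₀ := (hfar_out z₀ hz₀).of_adj haz₀ (fun h => by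
        have ha₀X := hall a₀ (Walk.end_mem_support wk)
        exact (mem_onionDomain_iff.1 (hC₀G (Finset.mem_coe.1 h))).2 ha₀X)
      refine farRight_of_walk_avoiding wk.reverse ha₀far (fun y hy h => ?_) p (by simp)
      rw [Walk.support_reverse, List.mem_reverse] at hy
      exact (mem_onionDomain_iff.1 (hC₀G (Finset.mem_coe.1 h))).2 (hall y hy)
    -- colours on `D₀` and position of its sites
    have hD₀col : ∀ u ∈ D₀, c u = 1 ∧ u ∉ G := by
      rintro u ⟨hufar, h, hh, hhu⟩
      have huC₀ : u ∉ C₀ := fun h' => hufar.not_mem (Finset.mem_coe.2 h')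
      by_cases huΛ : u ∈ Λ
      · have huG : u ∉ G := fun huG => huC₀ (hC₀cl h hh u huG hhu)
        exact ⟨(hcrust u h huΛ huG (hC₀G hh) hhu).2.1, huG⟩
      · exact ⟨hcpos u huΛ (hout h u (hC₀G hh) huΛ hhu), fun h' => huΛ (hGΛ h')⟩
    -- connectivity inside `D₀`
    have hD₀conn : ∀ d ∈ D₀, ∀ e ∈ D₀, ∃ wk : zdStarGraph.Walk d e, ∀ z ∈ wk.support, z ∈ D₀ := by
      rintro d ⟨hdfar, hd, hhd, hhdd⟩ e ⟨hefar, he, hhe, hhee⟩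
      obtain ⟨P₁, hP₁⟩ := exists_walk_of_farRight C₀ hdfar hefar
      obtain ⟨wk, hwk⟩ := exists_starWalk_starBoundary C₀ hC₀conn (fun h => hdfar.not_mem (Finset.mem_coe.2 h))
        ⟨hd, hhd, hhdd.symm⟩ ⟨he, hhe, hhee.symm⟩ P₁ hP₁
      have hwkfar := farRight_of_walk_avoiding wk hdfar (fun v hv h => (hwk v hv).1 (Finset.mem_coe.1 h))
      refine ⟨wk, fun z hz => ⟨hwkfar z hz, ?_⟩⟩
      obtain ⟨cc, hcc, hadj⟩ := (hwk z hz).2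
      exact ⟨cc, hcc, hadj.symm⟩
    have haD₀ : a ∈ D₀ := ⟨hfar_X a haΛ haG, g, hgC₀, hag.symm⟩
    have hW₀ : ∀ y ∈ W₀.support, y ∈ Λ ∧ c y = 1 := fun y hy => hπ y (hW₀π y hy)
    have hW₀G' : ∀ y ∈ W₀.support, y ∉ G := fun y hy h => hW₀G y hy (Finset.mem_coe.2 h)
    obtain ⟨z, hzΛ, hzside, htz⟩ := ht
    -- case 1: the endpoint `t` lies in `C₀`: the outside site `z` belongs to `D₀`
    by_cases htC₀ : t ∈ C₀
    · have hzD₀ : z ∈ D₀ := ⟨hfar_out z hzΛ, t, htC₀, htz⟩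
      obtain ⟨wk, hwk⟩ := hD₀conn a haD₀ z hzD₀
      refine mem_kSet_off_of_walk_avoiding hcpos hcneg hagree (W₀.append wk) (hπ v (Walk.start_mem_support π)).1
        (fun y hy => ?_) (fun y hy => ?_) (Or.inl hzΛ)
      · rw [Walk.mem_support_append_iff] at hy
        rcases hy with hy | hy
        · exact (hW₀ y hy).2
        · exact (hD₀col y (hwk y hy)).1
      · rw [Walk.mem_support_append_iff] at hy
        rcases hy with hy | hy
        · exact hW₀G' y hy
        · exact (hD₀col y (hwk y hy)).2
    -- case 2: reroute through `D₀` to the last exit `e` of `π` from the onion of `C₀`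
    have htfar : FarRight ↑C₀ t := (hfar_out z hzΛ).of_adj htz (fun h => htC₀ (Finset.mem_coe.1 h))
    obtain ⟨e, g', W₁, heg', hg', hW₁far, hW₁π⟩ := exists_split_first_not_far π.reverse htfar
      ⟨g, by rw [Walk.support_reverse, List.mem_reverse]; exact hgπ, fun h => h.not_mem (Finset.mem_coe.2 hgC₀)⟩
    have heD₀ : e ∈ D₀ := ⟨hW₁far e (Walk.end_mem_support W₁), g', Finset.mem_coe.1 hg', heg'.symm⟩
    obtain ⟨wk, hwk⟩ := hD₀conn a haD₀ e heD₀
    by_cases hwkΛ : ∀ y ∈ wk.support, y ∈ Λ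
    swap
    · -- the boundary walk leaves `Λ`: cut at the first exit, which is a witness
      push Not at hwkΛ
      obtain ⟨y, hy, hyΛ⟩ := hwkΛ
      obtain ⟨p, o, wk₁, hpo, ho, howk, hwk₁S, hwk₁wk⟩ := exists_split_first_mem (S := (↑Λ : Set (Site 2))ᶜ) wk
        (fun h => h (Finset.mem_coe.2 haΛ)) ⟨y, hy, fun h => hyΛ (Finset.mem_coe.1 h)⟩
      have hoΛ : o ∉ Λ := fun h => ho (Finset.mem_coe.2 h)
      have hco : c o = 1 := (hD₀col o (hwk o howk)).1
      have ho1 : 0 ≤ o 1 := by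
        by_contra h; push Not at h
        rw [hcneg o hoΛ h] at hco; exact absurd hco (by decide)
      have hside : OnSide 1 o := by unfold OnSide; simpa using ho1
      refine mem_kSet_off_of_walk_avoiding hcpos hcneg hagree (W₀.append wk₁) (hπ v (Walk.start_mem_support π)).1
        (fun y' hy' => ?_) (fun y' hy' => ?_) (Or.inr ⟨o, hoΛ, hside, hpo⟩)
      · rw [Walk.mem_support_append_iff] at hy'
        rcases hy' with hy' | hy'
        · exact (hW₀ y' hy').2
        · exact (hD₀col y' (hwk y' (hwk₁wk y' hy'))).1
      · rw [Walk.mem_support_append_iff] at hy'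
        rcases hy' with hy' | hy'
        · exact hW₀G' y' hy'
        · exact (hD₀col y' (hwk y' (hwk₁wk y' hy'))).2
    · -- the rerouted walk stays in `Λ`: recurse with fewer `Γ`-sites joined to the walk
      set π' : zdStarGraph.Walk v t := W₀.append (wk.append W₁.reverse) with hπ'
      have hmemπ' : ∀ y, y ∈ π'.support ↔ y ∈ W₀.support ∨ y ∈ wk.support ∨ y ∈ W₁.support := by
        intro y
        rw [hπ', Walk.mem_support_append_iff, Walk.mem_support_append_iff, Walk.support_reverse, List.mem_reverse]
      refine ih v t π' ?_ (fun y hy => ?_) hv ⟨z, hzΛ, hzside, htz⟩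
      · -- the filter strictly decreases
        have hsub : (G.filter fun h => ∃ u ∈ π'.support, u ∈ G ∧ (siteOpenGraph zdStarGraph (↑G : Set (Site 2))).Reachable h u) ⊆
            G.filter fun h => ∃ u ∈ π.support, u ∈ G ∧ (siteOpenGraph zdStarGraph (↑G : Set (Site 2))).Reachable h u := by
          intro h hh
          rw [Finset.mem_filter] at hh ⊢
          obtain ⟨hhG, u, hu, huG, hr⟩ := hh
          refine ⟨hhG, u, ?_, huG, hr⟩
          rcases (hmemπ' u).1 hu with hu | hu | hu
          · exact absurd huG (hW₀G' u hu)
          · exact absurd huG (hD₀col u (hwk u hu)).2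
          · have := hW₁π u hu
            rwa [Walk.support_reverse, List.mem_reverse] at this
        have hgF : g ∈ G.filter fun h => ∃ u ∈ π.support, u ∈ G ∧ (siteOpenGraph zdStarGraph (↑G : Set (Site 2))).Reachable h u :=
          Finset.mem_filter.2 ⟨hg, g, hgπ, hg, Reachable.refl _⟩
        have hgF' : g ∉ G.filter fun h => ∃ u ∈ π'.support, u ∈ G ∧ (siteOpenGraph zdStarGraph (↑G : Set (Site 2))).Reachable h u := by
          intro hh
          obtain ⟨-, u, hu, huG, hr⟩ := Finset.mem_filter.1 hh
          rcases (hmemπ' u).1 hu with hu | hu | hu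
          · exact hW₀G' u hu huG
          · exact (hD₀col u (hwk u hu)).2 huG
          · exact (hW₁far u hu).not_mem (Finset.mem_coe.2 ((hmemC₀ u).2 ⟨huG, hr⟩))
        have hlt := Finset.card_lt_card ((Finset.ssubset_iff_of_subset hsub).2 ⟨g, hgF, hgF'⟩)
        omega
      · rcases (hmemπ' y).1 hy with hy | hy | hy
        · exact hW₀ y hy
        · exact ⟨hwkΛ y hy, (hD₀col y (hwk y hy)).1⟩
        · have := hW₁π y hy
          rw [Walk.support_reverse, List.mem_reverse] at this
          exact hπ y this

/-- **The random volume is determined from outside** ("by maximality, `Γ` is determined from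
outside"): if `σ' = σ` off `Γ⁺(σ)` then `Γ⁺(σ') = Γ⁺(σ)`. [cite: GeorgiiHiguchi2000, Lemma 2.3 (proof)] -/
theorem onionDomain_eq_of_eq_off {c' : Site 2 → ℤˣ} (hagree : ∀ v, v ∉ onionDomain Λ c 1 → c' v = c v) :
    onionDomain Λ c' 1 = onionDomain Λ c 1 := by
  set G := onionDomain Λ c 1 with hGdef
  have hK'K : ∀ w, w ∈ kSet Λ c' 1 → w ∉ G → w ∈ kSet Λ c 1 := fun w hw hwG => mem_kSet_of_mem_kSet_off hagree hw hwG
  have hKK' : ∀ w, w ∈ kSet Λ c 1 → w ∉ G → w ∈ kSet Λ c' 1 := fun w hw hwG =>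
    mem_kSet_off_of_mem_kSet hcpos hcneg hHF hagree hw hwG
  -- `innerReach σ' = innerReach σ`
  have hX : ∀ p, p ∈ innerReach Λ c' 1 ↔ p ∈ innerReach Λ c 1 := by
    intro p
    constructor
    · rintro ⟨hp, a₀, ha₀, wk, hwkΛ, hwkK⟩
      have ha₀G : a₀ ∉ G := by
        obtain ⟨z, hz, hside, hadj⟩ := ha₀
        exact fun h => (mem_onionDomain_iff.1 h).2
          (mem_innerReach_of_adj_out (c := c) (hwkΛ a₀ (Walk.end_mem_support wk)) hz hside hadj)
      exact ⟨hp, a₀, ha₀, wk, hwkΛ, (innerReach_walk_off hKK' wk ha₀G hwkΛ hwkK).2⟩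
    · rintro ⟨hp, a₀, ha₀, wk, hwkΛ, hwkK⟩
      have hall := mem_innerReach_of_walk (c := c) ha₀ wk hwkΛ hwkK
      refine ⟨hp, a₀, ha₀, wk, hwkΛ, fun v hv hvK' => hwkK v hv (hK'K v hvK' fun hvG => ?_)⟩
      exact (mem_onionDomain_iff.1 hvG).2 (hall v (List.mem_of_mem_tail hv))
  ext p
  rw [mem_onionDomain_iff, mem_onionDomain_iff, hX p]

end Outside

end Literature.Probability.Percolation
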